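import Summits.ResolutionOfSingularities.ResolutionOfSingularities.Theorems.EquisingularLiftEquisingularLiftNatModelChainStep
import HarnessLib

/-!
# [OURS · L1 W4.5(b) · EL♮ kit K3″] THE MODEL POINT STEP WITH A GIVEN SECTION

Crux `EquisingularLiftNat` = stmt-ResolutionOfSingularities-20038 (route EquisingularLift), line `sections`; helper file
`--supports … --as helper` for the HSUB(ReachTC⁺)₃ assembly of res-L1-w45b-stub-1 (its `inv_step_regular` /
`inv_step_singular` blow up a section CHOSEN by the caller — e.g. inside a carrier — rather than the Hensel section that
K3 `modelPointStep` (p510112) constructs itself). HONEST FRAMING: OURS (cell res-hironaka, slot W4.5(b)); NOT a statement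
of any manuscript; AI-written, weaker than expert review. No `sorry`; standard axioms.

THE STEP (`modelPointStep_of_section`). Data: a DVR `O` with a surjection `θ : O ↠ k` onto a field; a proper `q : P → Spec O`
and a closed irreducible `Y` in the special fibre; a stage predicate `Ch` refining `Split.Chain P Y` and closed under horizontal
E1 steps; an upstairs stage `(X', σ', S')` with `X'` integral, regular, locally Noetherian and `σ' ≫ q` dominant; a downstairs
stage `(F, T)` (`F` integral) in a MODEL SQUARE `IsPullback j t (σ' ≫ q) (Spec θ)` with `j '' T = S'`; a closed point `x ∈ T`,
`T ⊄ {x}`, with `σ' (j x)` not the generic point of `Y`; a SECTION `s` of `σ' ≫ q` with `s(𝔪) = j x` (given, not constructed);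
blow-ups `τ : X'' → X'` of `ker s` and `υ : F₂ → F` of the reduced point `x`. OUTPUT: the new `Ch` stage on `X''`; `X''`
regular, locally Noetherian, integral, dominant over `Spec O`; `F₂` integral and the strict transform `closure (υ ⁻¹' (T ∖ {x}))`
irreducible; the centre identities `ker s · 𝒪_F = 𝔪_x` and its pull-back form on `F₂`; the support of `ker s` off the generic
point of `Y`; and the NEW MODEL SQUARE `j₂ : F₂ → X''` with `j₂ ≫ τ = υ ≫ j` and matching strict-transform sets.
Assembly of tree facts only: `ker_section_comap_eq_vanishingIdeal`, `section_isClosedImmersion_and_isRegular_ker`,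
`flat_kerSubschemeι_comp_of_section`, K2 `modelStep` (p509016), `isIrreducible_of_model` (p511521).

References: Q. Liu, *Algebraic Geometry and Arithmetic Curves* (2002), §8.1, Thm. 8.1.19; The Stacks Project, Tag 0805.
-/

set_option linter.dupNamespace false -- mandated namespace `Summit.<Summit>.<Problem>` of this single-conjunct summit
set_option linter.overlappingInstances false -- signatures carry `[IsDomain O] [IsDiscreteValuationRing O]`

noncomputable section

open CategoryTheory CategoryTheory.Limits AlgebraicGeometry TopologicalSpace Topology
open Literature.AlgebraicGeometry.Resolution
open AlgebraicGeometry.Scheme.IdealSheafData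
open Summit.ResolutionOfSingularities.ResolutionOfSingularities.Theses.EquisingularLift.Split
open Summit.ResolutionOfSingularities.ResolutionOfSingularities.Cruxes.EquisingularLift.StrataSplit

namespace Summit.ResolutionOfSingularities.ResolutionOfSingularities.Cruxes.EquisingularLiftNat.Sections

/-- **THE MODEL POINT STEP WITH A GIVEN SECTION (K3″).** In the model-square situation of K3 `modelPointStep`, but with the
section `s` through `j x` SUPPLIED by the caller and the blow-up `τ` of `ker s` supplied as well: the blow-up of the
downstairs ambient `F` at the reduced closed point `x ∈ T` (with `T ⊄ {x}`, `σ' (j x)` not generic in `Y`) is the special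
fibre of `τ`; the new upstairs stage satisfies `Ch`, is regular, locally Noetherian, integral and dominant over `Spec O`;
downstairs `F₂` is integral and the strict transform of `T` irreducible; `ker s · 𝒪_F = 𝔪_x`, its pull-back
`(ker s · 𝒪_{X''}) · 𝒪_{F₂} = 𝔪_x · 𝒪_{F₂}`, the support of `ker s` maps off the generic point of `Y`; and the new model
square `j₂` commutes with the old one and matches the strict-transform sets. No regularity of `F` at `x` and no
completeness of `O` are needed (they served only to construct a section). [cite: Liu2002, §8.1 and Thm. 8.1.19] -/
theorem modelPointStep_of_section (O : Type) [CommRing O] [IsDomain O] [IsDiscreteValuationRing O]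
    (k : Type) [Field k] (θ : O →+* k) (hθ : Function.Surjective θ)
    (P : Scheme.{0}) (q : P ⟶ Spec (.of O)) (Y : Set P) (hY : Y ⊆ q ⁻¹' {IsLocalRing.closedPoint O})
    (hYirr : IsIrreducible Y) (hYcl : IsClosed Y) [IsProper q]
    (Ch : ∀ X' : Scheme.{0}, (X' ⟶ P) → Set X' → Prop)
    (hChain : ∀ (X' : Scheme.{0}) (σ : X' ⟶ P) (S : Set X'), Ch X' σ S → Chain P Y X' σ S)
    (hStep : ∀ (X' X'' : Scheme.{0}) (σ' : X' ⟶ P) (S' : Set X') (C : X'.IdealSheafData) (τ : X'' ⟶ X'),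
      Ch X' σ' S' → IsBlowup τ C → Scheme.IsRegular C.subscheme → Flat (C.subschemeι ≫ σ' ≫ q) →
      σ' '' (C.support : Set X') ⊆ {x : P | ¬ IsGenericPoint x Y} →
      (C.support : Set X') ∩ (σ' ≫ q) ⁻¹' {IsLocalRing.closedPoint O} ⊆ S' →
      Ch X'' (τ ≫ σ') (closure (τ ⁻¹' (S' \ (C.support : Set X')))))
    -- the upstairs stage
    (X' : Scheme.{0}) (σ' : X' ⟶ P) (S' : Set X') (hCh : Ch X' σ' S')
    [IsIntegral X'] [IsLocallyNoetherian X'] (hreg : Scheme.IsRegular X')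
    [IsProper (σ' ≫ q)] (hdom : IsDominant (σ' ≫ q))
    -- the downstairs stage and the model square
    (F : Scheme.{0}) [IsIntegral F] (j : F ⟶ X') (t : F ⟶ Spec (.of k))
    (hsq : IsPullback j t (σ' ≫ q) (Spec.map (CommRingCat.ofHom θ)))
    (T : Set F) (hTS : j '' T = S')
    -- the point
    (x : F) (hxcl : IsClosed ({x} : Set F)) (hxT : x ∈ T) (hTx : ¬ T ⊆ {x}) (hw : ¬ IsGenericPoint (σ' (j x)) Y)
    -- the GIVEN section through `j x`
    (s : Spec (.of O) ⟶ X') (hs : s ≫ σ' ≫ q = 𝟙 _) (hss₀ : s (IsLocalRing.closedPoint O) = j x)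
    -- the two blow-ups
    (X'' : Scheme.{0}) (τ : X'' ⟶ X') (hτ : IsBlowup τ s.ker)
    (F₂ : Scheme.{0}) (υ : F₂ ⟶ F) (hυ : IsBlowup υ (vanishingIdeal ⟨{x}, hxcl⟩)) :
    Ch X'' (τ ≫ σ') (closure (τ ⁻¹' (S' \ (s.ker.support : Set X')))) ∧
    Scheme.IsRegular X'' ∧ IsLocallyNoetherian X'' ∧ IsIntegral X'' ∧ IsDominant ((τ ≫ σ') ≫ q) ∧
    IsIntegral F₂ ∧ IsIrreducible (closure (υ ⁻¹' (T \ {x}))) ∧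
    s.ker.comap j = vanishingIdeal ⟨{x}, hxcl⟩ ∧
    (∀ c ∈ (s.ker.support : Set X'), ¬ IsGenericPoint (σ' c) Y) ∧
    Scheme.IsRegular s.ker.subscheme ∧ Flat (s.ker.subschemeι ≫ σ' ≫ q) ∧
    ∃ (j₂ : F₂ ⟶ X'') (t₂ : F₂ ⟶ Spec (.of k)),
      IsPullback j₂ t₂ ((τ ≫ σ') ≫ q) (Spec.map (CommRingCat.ofHom θ)) ∧ j₂ ≫ τ = υ ≫ j ∧
      (s.ker.comap τ).comap j₂ = (vanishingIdeal ⟨{x}, hxcl⟩ : F.IdealSheafData).comap υ ∧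
      j₂ '' closure (υ ⁻¹' (T \ {x})) = closure (τ ⁻¹' (S' \ (s.ker.support : Set X'))) := by
  classical
  set r' : X' ⟶ Spec (.of O) := σ' ≫ q with hr'
  set s₀ := IsLocalRing.closedPoint O with hs₀
  haveI := hdom
  haveI : IsClosedImmersion (Spec.map (CommRingCat.ofHom θ)) := IsClosedImmersion.spec_of_surjective _ hθ
  haveI hjci : IsClosedImmersion j := MorphismProperty.IsStableUnderBaseChange.of_isPullback hsq.flip inferInstance
  have hrangej : Set.range j = r' ⁻¹' {s₀} := by
    rw [range_eq_preimage_of_isPullback hsq, range_specMap_of_surjective_of_field θ hθ]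
  have hrs : ∀ p : Spec (.of O), r' (s p) = p := fun p => by
    rw [← Scheme.Hom.comp_apply, hs]; rfl
  -- (1) the centre `C = ker s`: regular, flat, special fibre the reduced point `x`
  haveI : IsSeparated r' := inferInstance
  obtain ⟨_, hCreg, -, hCsupp⟩ := section_isClosedImmersion_and_isRegular_ker O X' r' s hs
  have hCflat : Flat (s.ker.subschemeι ≫ σ' ≫ q) := flat_kerSubschemeι_comp_of_section O r' s hs
  have hrange' : Set.range (j ≫ r') ⊆ {s₀} := by
    rintro _ ⟨y, rfl⟩
    have : j y ∈ Set.range j := ⟨y, rfl⟩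
    rw [hrangej] at this
    exact this
  have hCD : s.ker.comap j = vanishingIdeal ⟨{x}, hxcl⟩ :=
    ker_section_comap_eq_vanishingIdeal O X' F r' s hs j hrange' x hss₀.symm hxcl
  -- (2) off the generic point of `Y`
  have hoffs : ∀ c ∈ (s.ker.support : Set X'), ¬ IsGenericPoint (σ' c) Y := by
    intro c hc hgen
    rw [hCsupp] at hc
    obtain ⟨p, rfl⟩ := hc
    have hps : p = s₀ := by
      rw [← hrs p]
      show (σ' ≫ q) (s p) = s₀
      rw [Scheme.Hom.comp_apply]
      exact hY hgen.mem
    rw [hps, hss₀] at hgen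
    exact hw hgen
  have hoff : σ' '' (s.ker.support : Set X') ⊆ {y : P | ¬ IsGenericPoint y Y} := by
    rintro _ ⟨c, hc, rfl⟩
    exact hoffs c hc
  have hDT : ((vanishingIdeal ⟨{x}, hxcl⟩ : F.IdealSheafData).support : Set F) ⊆ T := by
    rw [coe_support_vanishingIdeal]
    exact Set.singleton_subset_iff.mpr hxT
  -- (3) the centre is a proper ideal sheaf: `T` has a point other than `x`
  have hCne : s.ker ≠ ⊥ := by
    intro h
    apply hTx
    intro y hy
    have hyC : j y ∈ (s.ker.support : Set X') := by rw [h, Scheme.IdealSheafData.support_bot]; trivial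
    rw [hCsupp] at hyC
    obtain ⟨p, hp⟩ := hyC
    have hps : p = s₀ := by
      rw [← hrs p, hp]
      exact hrange' ⟨y, rfl⟩
    rw [hps, hss₀] at hp
    exact hjci.isClosedEmbedding.injective hp.symm
  have hDne : (vanishingIdeal ⟨{x}, hxcl⟩ : F.IdealSheafData) ≠ ⊥ := by
    intro h
    apply hTx
    intro y _
    have : y ∈ ((vanishingIdeal ⟨{x}, hxcl⟩ : F.IdealSheafData).support : Set F) := by
      rw [h, Scheme.IdealSheafData.support_bot]; trivial
    rwa [coe_support_vanishingIdeal] at this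
  -- (4) run the model step (K2)
  obtain ⟨hCh'', hreg'', hnoeth'', j₂, t₂, hsq₂, hcomm, hsets⟩ :=
    modelStep O k θ hθ P q Y Ch hStep X' σ' S' hCh hreg F j t hsq T hTS s.ker (vanishingIdeal ⟨{x}, hxcl⟩) hCD hCreg hCflat
      hoff hDT X'' τ hτ F₂ υ hυ
  haveI hint'' : IsIntegral X'' := hτ.isIntegral hCne
  haveI : IsDominant τ := isDominant_of_isBlowup hτ hCne
  have hdom'' : IsDominant ((τ ≫ σ') ≫ q) := by rw [Category.assoc]; infer_instance
  have hsuppx : ((vanishingIdeal ⟨{x}, hxcl⟩ : F.IdealSheafData).support : Set F) = {x} := by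
    rw [coe_support_vanishingIdeal]; rfl
  rw [hsuppx] at hsets
  -- (5) downstairs: `F₂` integral, the strict transform of `T` irreducible
  haveI hF₂ : IsIntegral F₂ := hυ.isIntegral hDne
  haveI hnoeth''' := hnoeth''
  haveI hj₂ci : IsClosedImmersion j₂ := MorphismProperty.IsStableUnderBaseChange.of_isPullback hsq₂.flip inferInstance
  have hT₂irr : IsIrreducible (closure (υ ⁻¹' (T \ {x}))) :=
    isIrreducible_of_model hYirr hYcl (hChain _ _ _ hCh'') j₂ _ isClosed_closure hsets
  -- (6) the carrier identity pulled back to `F₂`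
  have hE : (s.ker.comap τ).comap j₂ = (vanishingIdeal ⟨{x}, hxcl⟩ : F.IdealSheafData).comap υ := by
    rw [← hCD, ← Scheme.IdealSheafData.comap_comp, ← Scheme.IdealSheafData.comap_comp, hcomm]
  exact ⟨hCh'', hreg'', hnoeth'', hint'', hdom'', hF₂, hT₂irr, hCD, hoffs, hCreg, hCflat, j₂, t₂, hsq₂, hcomm, hE, hsets⟩

end Summit.ResolutionOfSingularities.ResolutionOfSingularities.Cruxes.EquisingularLiftNat.Sections

end
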